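import Literature.Probability.RandomPlanarGeometry.SAWSlabPolygonLimit
import Literature.Probability.RandomPlanarGeometry.SAWWedgeBoundedProfile
import Literature.Probability.RandomPlanarGeometry.SAWTubeInsertionMargin
import Mathlib.Algebra.Order.Chebyshev
import HarnessLib

/-!
# Polygons in tubes `R[1,T] = ℤ × {0,…,T}^{d-1}`: `μ(R[1,h]) ≤ μ_Polygon(R[1,2h+1]) ≤ μ(R[1,2h+1])` in every dimension,
# and the polygon analogue of Madras–Slade (8.2.12): `lim_T μ_Polygon(R[1,T]) = μ(ℤ^d)`

Topic `Literature/Probability/RandomPlanarGeometry` (continues `SAWTubePolygons.lean`: `q̃_N(R) = Zd.tubePolygonCount`,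
`π(R) = Zd.tubePolygonRate`; `SAWTubeRenewal.lean`: the floor-to-floor bridges `𝓑_n⟨T⟩ = Zd.tubeBridges`, `β_n⟨T⟩ = Zd.tubeBeta`;
`SAWSlabPolygonLimit.lean`: `β_n⟨T⟩^{1/n} → μ⟨R⟩`, `eventually_pow_le_tubeBeta`; `SAWWedgeBoundedProfile.lean`: the envelope
`CornerDecomp.exists_tubeCount_le_mul_pow`; `SAWTubeLocality.lean`: (8.2.12) `Zd.tendsto_tubeConnectiveConstant`;
`SAWTubeInsertionMargin.lean`: `TubeInsertion.tubePolygonRate_lt_succ`; planar companion `SAWStripPolygonLowerBound.lean`).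

Source: N. Madras, G. Slade, *The Self-Avoiding Walk* (Birkhäuser 1993), §8.2, Theorem 8.2.1 (8.2.12) (p. 269) and
Theorem 8.2.2 (pp. 270–271). Printed for polygons only as (a) existence of `μ_Polygon(R)`, (b) `μ_Polygon(R) < μ(R)` for
`k = 1`, (c) `μ_Polygon(R) = μ(R)` for `k ≥ 2` — no `T → ∞` statement for polygons is printed there; S. G. Whittington,
LNP 775 ch. 2 §2.9.2 p. 38, prints "`lim_{L→∞} κ(L) = κ`" for polygons in SLABS (`k = d-1 ≥ 2`) and, for slits and prisms
(`k = 1`), only existence and the strict inequality (after Soteros–Whittington 1988/1989); A. J. Guttmann, I. Jensen,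
LNP 775 ch. 10 §10.1 pp. 236–237, use `π_w ↑ μ` with the Daoud–de Gennes scaling (physics, not a theorem).
This file proves, in every dimension `d + 2 ≥ 2`:

* **`Zd.tubeConnectiveConstant_le_tubePolygonRate_double'`** — `μ(R[1,h]) ≤ π(R[1,2h+1])` (two equal-span floor-to-floor
  bridges of `R[1,h]` glued, through the last coordinate, into a polygon of `R[1,2h+1]`; Cauchy–Schwarz over the spans:
  `β_n⟨h⟩² ≤ (n+1) q̃_{2n+4h+6}(R[1,2h+1])`);
* **`Zd.tubePolygonRate_le_tubeConnectiveConstant'`** — `π(R[1,T]) ≤ μ(R[1,T])` (`q̃_N ≤ c_{N-1}(R)`);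
* **`Zd.tubeConnectiveConstant_half_le_tubePolygonRate'`** — `μ(R[1,⌊(T-1)/2⌋]) ≤ π(R[1,T])` for every `T ≥ 1`;
* **`Zd.tendsto_tubePolygonRate`** — `π(R[1,T]) → μ(ℤ^{d+2})` as `T → ∞` (polygon analogue of (8.2.12), `k = 1`);
  `Zd.tendsto_tubePolygonRate_of_le` — the same for every `R[k,T]`, `1 ≤ k ≤ d+1` (with Theorem 8.2.2 (c) for `k ≥ 2`).

The planar case (`d + 2 = 2`) of the lower bound, with the planar-only upper companion `π(S_T) ≤ μ(S_{T-1})`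
(`SAWStripPolygonWallBound.lean`) and numeric corollaries, is `SAWStripPolygonLowerBound.lean`
(`Zd.tubeConnectiveConstant_le_tubePolygonRate_double`); this file redoes the gluing in every dimension, directly on
the vertex functions of `tubePolygonPairs` (no vertex lists). Label (lit-1 g13, 2026-08-23): NEW-IN-WRITING for the two
inequalities (all `d`) and for the limit statement with `k = 1`; for `k ≥ 2` the limit is a CONSOLIDATION of print
(M–S Theorem 8.2.2 (c) + (8.2.12); slabs: LNP 775 p. 38); in `d + 2 = 2` CONSOLIDATION-adjacent pending Soteros–Whittington
1988 / Alm–Janson 1990 (unheld: acq-10422 / acq-10417). Why novel: M–S Theorem 8.2.2 gives existence, and strictness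
(`k = 1`) / equality (`k > 1`) against walks of the SAME tube, but no `T → ∞` statement for polygons; for `k = 1`, where
`μ_Polygon(R) < μ(R)`, we prove `μ(R[1,⌊(T-1)/2⌋]) ≤ π(R[1,T]) ≤ μ(R[1,T])` and hence `π(R[1,T]) → μ` in every dimension
(the gluing is the tube transplant of the printed `ℤ^d` two-walk polygon constructions, Madras–Slade §3.2).
-/

noncomputable section

open Filter Topology Finset Literature.Probability.LatticeModels Literature.Probability.Percolation SimpleGraph
open scoped BigOperators

namespace Literature.Probability.RandomPlanarGeometry.SAW.Zd

namespace TubePolygonLower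

variable {d : ℕ}

/-! ### Coordinates: the column `x₀`, the height `x_{d+1}`, the reflection of the height -/

/-- The height coordinate (the last one). [folklore] -/
def hI (d : ℕ) : Fin (d + 2) := Fin.last (d + 1)

/-- The height coordinate is not the column coordinate. [folklore] -/
private theorem hI_ne_zero : hI d ≠ 0 := by
  intro h; have := congrArg Fin.val h; simp [hI] at this

/-- `1 ≤ (hI d).val`. [folklore] -/
private theorem one_le_hI : 1 ≤ (hI d).val := by simp [hI]

/-- The point `c e₀ + y e_{d+1}`. [folklore] -/
def pt (c y : ℤ) : Site (d + 2) := Pi.single 0 c + Pi.single (hI d) y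

/-- Column of `pt`. [folklore] -/
@[simp] private theorem pt_zero (c y : ℤ) : (pt c y : Site (d + 2)) 0 = c := by
  simp [pt, Pi.single_eq_of_ne (hI_ne_zero (d := d)).symm]

/-- Height of `pt`. [folklore] -/
@[simp] private theorem pt_hI (c y : ℤ) : (pt c y : Site (d + 2)) (hI d) = y := by
  simp [pt, Pi.single_eq_of_ne (hI_ne_zero (d := d))]

/-- Middle coordinates of `pt`. [folklore] -/
private theorem pt_mid (c y : ℤ) {i : Fin (d + 2)} (hi0 : i ≠ 0) (hiH : i ≠ hI d) : (pt c y : Site (d + 2)) i = 0 := by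
  simp [pt, Pi.single_eq_of_ne hi0, Pi.single_eq_of_ne hiH]

/-- The reflection of the height `y ↦ 2h+1-y`. [folklore] -/
def vrefl (h : ℕ) (p : Site (d + 2)) : Site (d + 2) := p + Pi.single (hI d) (2 * h + 1 - 2 * p (hI d))

/-- Column of the reflection. [folklore] -/
@[simp] private theorem vrefl_zero (h : ℕ) (p : Site (d + 2)) : vrefl h p 0 = p 0 := by
  simp [vrefl, Pi.single_eq_of_ne (hI_ne_zero (d := d)).symm]

/-- Height of the reflection. [folklore] -/
@[simp] private theorem vrefl_hI (h : ℕ) (p : Site (d + 2)) : vrefl h p (hI d) = 2 * h + 1 - p (hI d) := by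
  simp [vrefl]; ring

/-- Other coordinates of the reflection. [folklore] -/
private theorem vrefl_of_ne (h : ℕ) (p : Site (d + 2)) {i : Fin (d + 2)} (hi : i ≠ hI d) : vrefl h p i = p i := by
  simp [vrefl, Pi.single_eq_of_ne hi]

/-- `pt (c+1) y = pt c y + e₀`. [folklore] -/
private theorem pt_succ_col (c y : ℤ) : (pt (c + 1) y : Site (d + 2)) = pt c y + Pi.single 0 1 := by
  simp only [pt, Pi.single_add]; abel

/-- `pt c (y+1) = pt c y + e_{d+1}`. [folklore] -/
private theorem pt_succ_ht (c y : ℤ) : (pt c (y + 1) : Site (d + 2)) = pt c y + Pi.single (hI d) 1 := by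
  simp only [pt, Pi.single_add]; abel

/-- Horizontal neighbours. [folklore] -/
private theorem pt_adj_right (c y : ℤ) : (zdGraph (d + 2)).Adj (pt c y : Site (d + 2)) (pt (c + 1) y) := by
  rw [zdGraph_adj_iff]; exact ⟨0, Or.inl (pt_succ_col c y)⟩

/-- Vertical neighbours. [folklore] -/
private theorem pt_adj_up (c y : ℤ) : (zdGraph (d + 2)).Adj (pt c y : Site (d + 2)) (pt c (y + 1)) := by
  rw [zdGraph_adj_iff]; exact ⟨hI d, Or.inl (pt_succ_ht c y)⟩

/-- The origin is `pt 0 0`. [folklore] -/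
private theorem pt_zero_zero : (pt 0 0 : Site (d + 2)) = 0 := by simp [pt]

/-- The reflection of `pt c y`. [folklore] -/
private theorem vrefl_pt (h : ℕ) (c y : ℤ) : vrefl h (pt c y : Site (d + 2)) = pt c (2 * h + 1 - y) := by
  funext j
  by_cases hjH : j = hI d
  · subst hjH; rw [vrefl_hI, pt_hI, pt_hI]
  · rw [vrefl_of_ne h _ hjH]
    by_cases hj0 : j = 0
    · subst hj0; rw [pt_zero, pt_zero]
    · rw [pt_mid _ _ hj0 hjH, pt_mid _ _ hj0 hjH]

/-- The reflection preserves adjacency. [folklore] -/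
private theorem vrefl_adj (h : ℕ) {x y : Site (d + 2)} (hxy : (zdGraph (d + 2)).Adj x y) :
    (zdGraph (d + 2)).Adj (vrefl h x) (vrefl h y) := by
  rw [zdGraph_adj_iff] at hxy ⊢
  obtain ⟨i, hi⟩ := hxy
  refine ⟨i, ?_⟩
  by_cases hiH : i = hI d
  · subst hiH
    rcases hi with hxy | hxy
    · right; funext j
      by_cases hj : j = hI d
      · subst hj; simp only [Pi.add_apply, vrefl_hI, hxy, Pi.single_eq_same]; ring
      · rw [Pi.add_apply, vrefl_of_ne h _ hj, vrefl_of_ne h _ hj, hxy]; simp [Pi.single_eq_of_ne hj]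
    · left; funext j
      by_cases hj : j = hI d
      · subst hj; simp only [Pi.add_apply, vrefl_hI, hxy, Pi.single_eq_same]; ring
      · rw [Pi.add_apply, vrefl_of_ne h _ hj, vrefl_of_ne h _ hj, hxy]; simp [Pi.single_eq_of_ne hj]
  · have e0 : (Pi.single i (1 : ℤ) : Site (d + 2)) (hI d) = 0 := Pi.single_eq_of_ne (Ne.symm hiH) _
    rcases hi with hxy | hxy
    · left; funext j
      by_cases hj : j = hI d
      · subst hj; simp only [Pi.add_apply, vrefl_hI, hxy, e0, add_zero]
      · rw [Pi.add_apply, vrefl_of_ne h _ hj, vrefl_of_ne h _ hj, hxy, Pi.add_apply]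
    · right; funext j
      by_cases hj : j = hI d
      · subst hj; simp only [Pi.add_apply, vrefl_hI, hxy, e0, add_zero]
      · rw [Pi.add_apply, vrefl_of_ne h _ hj, vrefl_of_ne h _ hj, hxy, Pi.add_apply]

/-- The reflection is injective. [folklore] -/
private theorem vrefl_injective (h : ℕ) : Function.Injective (vrefl (d := d) h) := fun x y hxy => by
  have hH : x (hI d) = y (hI d) := by
    have := congrFun hxy (hI d); simp only [vrefl_hI] at this; linarith
  funext j
  by_cases hj : j = hI d
  · subst hj; exact hH
  · have := congrFun hxy j; rwa [vrefl_of_ne h _ hj, vrefl_of_ne h _ hj] at this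

/-! ### Floor-to-floor bridges of `R[1,h]` -/

variable {h n : ℕ}

/-- The facts about a floor-to-floor bridge of `R[1,h]` used below. [cite: MadrasSlade1993, §8.2, proof of Theorem 8.2.1 (the class `𝓑_N⟨T⟩`, p. 270)] -/
private theorem bridge_facts {b : ℕ → Site (d + 2)} (hb : b ∈ tubeBridges (d + 2) 1 h n) :
    b 0 = 0 ∧ (∀ t, n ≤ t → b t = b n) ∧ (∀ t < n, (zdGraph (d + 2)).Adj (b t) (b (t + 1))) ∧ Set.InjOn b {t | t ≤ n} ∧
      (∀ t (i : Fin (d + 2)), 1 ≤ i.val → 0 ≤ b t i ∧ b t i ≤ (h : ℤ)) ∧ (∀ t, 0 ≤ b t 0 ∧ b t 0 ≤ b n 0) ∧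
      (∀ i : Fin (d + 2), 1 ≤ i.val → b n i = 0) ∧ b n 0 ≤ (n : ℤ) := by
  obtain ⟨hbr, hR, hfloor⟩ := mem_tubeBridges.1 hb
  obtain ⟨hs, hB⟩ := mem_bridges.1 hbr
  obtain ⟨h0, hfr, hadj, hinj⟩ := mem_saws.1 hs
  have hrow : ∀ t (i : Fin (d + 2)), 1 ≤ i.val → 0 ≤ b t i ∧ b t i ≤ (h : ℤ) := fun t i hi => by
    rcases le_or_gt t n with ht | ht
    · exact hR t ht i hi
    · rw [hfr t ht.le]; exact hR n le_rfl i hi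
  have hcol : ∀ t, 0 ≤ b t 0 ∧ b t 0 ≤ b n 0 := fun t => by
    rcases Nat.eq_zero_or_pos t with rfl | ht0
    · rw [h0]
      rcases Nat.eq_zero_or_pos n with rfl | hn0
      · simp [h0]
      · have := hB n hn0 le_rfl; rw [h0] at this; simp only [Pi.zero_apply] at this ⊢; exact ⟨le_rfl, this.1.le⟩
    · rcases le_or_gt t n with ht | ht
      · have := hB t ht0 ht; rw [h0] at this; simp only [Pi.zero_apply] at this; exact ⟨this.1.le, this.2⟩
      · rw [hfr t ht.le]
        rcases Nat.eq_zero_or_pos n with rfl | hn0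
        · simp [h0]
        · have := hB n hn0 le_rfl; rw [h0] at this; simp only [Pi.zero_apply] at this; exact ⟨this.1.le, le_rfl⟩
  have hfl : ∀ i : Fin (d + 2), 1 ≤ i.val → b n i = 0 := fun i hi => by
    have := congrFun hfloor i
    simpa [vproj, hi] using this
  refine ⟨h0, hfr, hadj, hinj, hrow, hcol, hfl, ?_⟩
  have := abs_apply_le_of_adj h0 hadj n le_rfl 0
  exact (abs_le.1 this).2

/-- The end of a floor-to-floor bridge is `M e₀`. [folklore] -/
private theorem bridge_end {b : ℕ → Site (d + 2)} (hb : b ∈ tubeBridges (d + 2) 1 h n) : b n = pt (b n 0) 0 := by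
  obtain ⟨-, -, -, -, -, -, hfl, -⟩ := bridge_facts hb
  funext j
  by_cases hj0 : j = 0
  · subst hj0; simp
  · by_cases hjH : j = hI d
    · subst hjH; rw [pt_hI]; exact hfl _ one_le_hI
    · rw [pt_mid _ _ hj0 hjH]
      exact hfl j (Nat.one_le_iff_ne_zero.2 fun h0 => hj0 (Fin.ext h0))

/-! ### The glued polygon -/

/-- The vertex function of the glued polygon (`M = b₁ n 0` the common span): `b₁`, the column `M+1` upwards in the last
coordinate, the reflected `b₂` backwards, the column `-1` downwards; frozen after `2n + 4h + 5` steps.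
[cite: MadrasSlade1993, Theorem 8.2.2 (this file's gluing)] -/
def glue (h n : ℕ) (b₁ b₂ : ℕ → Site (d + 2)) (t : ℕ) : Site (d + 2) :=
  if t ≤ n then b₁ t
  else if t ≤ n + 2 * h + 2 then pt (b₁ n 0 + 1) ((t : ℤ) - n - 1)
  else if t ≤ 2 * n + 2 * h + 3 then vrefl h (b₂ (2 * n + 2 * h + 3 - t))
  else pt (-1) (2 * n + 4 * h + 5 - (min t (2 * n + 4 * h + 5) : ℕ))

/-- Piece A. [folklore] -/
private theorem glue_A {b₁ b₂ : ℕ → Site (d + 2)} {t : ℕ} (ht : t ≤ n) : glue h n b₁ b₂ t = b₁ t := by simp [glue, ht]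

/-- Piece B. [folklore] -/
private theorem glue_B {b₁ b₂ : ℕ → Site (d + 2)} {t : ℕ} (ht : n < t) (ht' : t ≤ n + 2 * h + 2) :
    glue h n b₁ b₂ t = pt (b₁ n 0 + 1) ((t : ℤ) - n - 1) := by simp [glue, not_le.2 ht, ht']

/-- Piece C. [folklore] -/
private theorem glue_C {b₁ b₂ : ℕ → Site (d + 2)} {t : ℕ} (ht : n + 2 * h + 2 < t) (ht' : t ≤ 2 * n + 2 * h + 3) :
    glue h n b₁ b₂ t = vrefl h (b₂ (2 * n + 2 * h + 3 - t)) := by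
  simp [glue, not_le.2 (show n < t by omega), not_le.2 ht, ht']

/-- Piece D. [folklore] -/
private theorem glue_D {b₁ b₂ : ℕ → Site (d + 2)} {t : ℕ} (ht : 2 * n + 2 * h + 3 < t) (ht' : t ≤ 2 * n + 4 * h + 5) :
    glue h n b₁ b₂ t = pt (-1) (2 * n + 4 * h + 5 - (t : ℤ)) := by
  simp only [glue, not_le.2 (show n < t by omega), not_le.2 (show n + 2 * h + 2 < t by omega), not_le.2 ht, if_false,
    min_eq_left ht']

/-- Frozen after `2n + 4h + 5` steps. [folklore] -/
private theorem glue_frozen {b₁ b₂ : ℕ → Site (d + 2)} {t : ℕ} (ht : 2 * n + 4 * h + 5 ≤ t) :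
    glue h n b₁ b₂ t = glue h n b₁ b₂ (2 * n + 4 * h + 5) := by
  simp only [glue, not_le.2 (show n < t by omega), not_le.2 (show n + 2 * h + 2 < t by omega),
    not_le.2 (show 2 * n + 2 * h + 3 < t by omega), if_false, min_eq_right ht,
    not_le.2 (show n < 2 * n + 4 * h + 5 by omega), not_le.2 (show n + 2 * h + 2 < 2 * n + 4 * h + 5 by omega),
    not_le.2 (show 2 * n + 2 * h + 3 < 2 * n + 4 * h + 5 by omega), min_self]

/-- **The glued vertex function is a rooted polygon of `R[1,2h+1]`** when the two bridges have the same span: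
`(0, glue) ∈ tubePolygonPairs (d+2) 1 (2h+1) (2n+4h+6)`. [cite: MadrasSlade1993, Theorem 8.2.2 (this file's gluing)] -/
theorem glue_mem {b₁ b₂ : ℕ → Site (d + 2)} (hb₁ : b₁ ∈ tubeBridges (d + 2) 1 h n) (hb₂ : b₂ ∈ tubeBridges (d + 2) 1 h n)
    (hM : b₁ n 0 = b₂ n 0) : ((0 : Site (d + 2)), glue h n b₁ b₂) ∈ tubePolygonPairs (d + 2) 1 (2 * h + 1) (2 * n + 4 * h + 6) := by
  classical
  obtain ⟨h10, h1fr, h1adj, h1inj, h1row, h1col, h1fl, -⟩ := bridge_facts hb₁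
  obtain ⟨h20, h2fr, h2adj, h2inj, h2row, h2col, h2fl, -⟩ := bridge_facts hb₂
  have hE1 := bridge_end hb₁
  have hE2 := bridge_end hb₂
  have hM0 : 0 ≤ b₁ n 0 := (h1col n).1
  -- coordinates of the pieces: column and height, and the middle coordinates stay in `[0, h]`
  have hA : ∀ t, t ≤ n → 0 ≤ glue h n b₁ b₂ t 0 ∧ glue h n b₁ b₂ t 0 ≤ b₁ n 0 ∧ 0 ≤ glue h n b₁ b₂ t (hI d) ∧
      glue h n b₁ b₂ t (hI d) ≤ h := fun t ht => by
    rw [glue_A ht]; exact ⟨(h1col t).1, (h1col t).2, (h1row t _ one_le_hI).1, (h1row t _ one_le_hI).2⟩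
  have hB : ∀ t, n < t → t ≤ n + 2 * h + 2 → glue h n b₁ b₂ t 0 = b₁ n 0 + 1 ∧
      glue h n b₁ b₂ t (hI d) = (t : ℤ) - n - 1 := fun t ht ht' => by
    rw [glue_B ht ht', pt_zero, pt_hI]; exact ⟨rfl, rfl⟩
  have hC : ∀ t, n + 2 * h + 2 < t → t ≤ 2 * n + 2 * h + 3 → 0 ≤ glue h n b₁ b₂ t 0 ∧ glue h n b₁ b₂ t 0 ≤ b₁ n 0 ∧
      (h : ℤ) + 1 ≤ glue h n b₁ b₂ t (hI d) ∧ glue h n b₁ b₂ t (hI d) ≤ 2 * h + 1 := fun t ht ht' => by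
    rw [glue_C ht ht']
    have := h2col (2 * n + 2 * h + 3 - t); have := h2row (2 * n + 2 * h + 3 - t) _ one_le_hI
    simp only [vrefl_zero, vrefl_hI]
    refine ⟨?_, ?_, ?_, ?_⟩ <;> omega
  have hD : ∀ t, 2 * n + 2 * h + 3 < t → t ≤ 2 * n + 4 * h + 5 → glue h n b₁ b₂ t 0 = -1 ∧
      glue h n b₁ b₂ t (hI d) = 2 * n + 4 * h + 5 - (t : ℤ) := fun t ht ht' => by
    rw [glue_D ht ht', pt_zero, pt_hI]; exact ⟨rfl, rfl⟩
  -- every vertex lies in the tube `R[1, 2h+1]`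
  have hTube : ∀ t, t ≤ 2 * n + 4 * h + 5 → InTube (d + 2) 1 (2 * h + 1) (glue h n b₁ b₂ t) := by
    intro t ht i hi
    by_cases hiH : i = hI d
    · subst hiH
      rcases le_or_gt t n with h1 | h1
      · have := hA t h1; push_cast; omega
      rcases le_or_gt t (n + 2 * h + 2) with h2 | h2
      · have := hB t h1 h2; push_cast; omega
      rcases le_or_gt t (2 * n + 2 * h + 3) with h3 | h3
      · have := hC t h2 h3; push_cast; omega
      · have := hD t h3 ht; push_cast; omega
    · have hi0 : i ≠ 0 := by intro h0; rw [h0] at hi; simp at hi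
      rcases le_or_gt t n with h1 | h1
      · rw [glue_A h1]; have := h1row t i hi; push_cast; omega
      rcases le_or_gt t (n + 2 * h + 2) with h2 | h2
      · rw [glue_B h1 h2, pt_mid _ _ hi0 hiH]; exact ⟨le_rfl, by positivity⟩
      rcases le_or_gt t (2 * n + 2 * h + 3) with h3 | h3
      · rw [glue_C h2 h3, vrefl_of_ne h _ hiH]; have := h2row (2 * n + 2 * h + 3 - t) i hi; push_cast; omega
      · rw [glue_D h3 ht, pt_mid _ _ hi0 hiH]; exact ⟨le_rfl, by positivity⟩
  -- adjacency
  have hadj : ∀ t, t + 1 ≤ 2 * n + 4 * h + 5 → (zdGraph (d + 2)).Adj (glue h n b₁ b₂ t) (glue h n b₁ b₂ (t + 1)) := by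
    intro t ht
    rcases Nat.lt_or_ge t n with h1 | h1
    · rw [glue_A h1.le, glue_A (by omega)]; exact h1adj t h1
    rcases h1.eq_or_lt with h2 | h2
    · -- junction A | B
      subst h2
      rw [glue_A le_rfl, glue_B (by omega) (by omega), hE1, pt_zero,
        show ((n + 1 : ℕ) : ℤ) - n - 1 = 0 by push_cast; ring]
      exact pt_adj_right _ _
    rcases Nat.lt_or_ge t (n + 2 * h + 2) with h3 | h3
    · rw [glue_B h2 h3.le, glue_B (by omega) (by omega),
        show ((t + 1 : ℕ) : ℤ) - n - 1 = ((t : ℤ) - n - 1) + 1 by push_cast; ring]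
      exact pt_adj_up _ _
    rcases h3.eq_or_lt with h4 | h4
    · -- junction B | C
      subst h4
      rw [glue_B h2 le_rfl, glue_C (by omega) (by omega), show 2 * n + 2 * h + 3 - (n + 2 * h + 2 + 1) = n by omega, hE2,
        vrefl_pt, ← hM, show ((n + 2 * h + 2 : ℕ) : ℤ) - n - 1 = 2 * h + 1 - 0 by push_cast; ring]
      exact (pt_adj_right _ _).symm
    rcases Nat.lt_or_ge t (2 * n + 2 * h + 3) with h5 | h5
    · rw [glue_C h4 h5.le, glue_C (by omega) (by omega)]
      have e : 2 * n + 2 * h + 3 - t = (2 * n + 2 * h + 3 - (t + 1)) + 1 := by omega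
      rw [e]
      exact (vrefl_adj h (h2adj _ (by omega))).symm
    rcases h5.eq_or_lt with h6 | h6
    · -- junction C | D
      subst h6
      rw [glue_C h4 le_rfl, Nat.sub_self, h20, glue_D (by omega) (by omega), ← pt_zero_zero, vrefl_pt,
        show 2 * n + 4 * h + 5 - ((2 * n + 2 * h + 3 + 1 : ℕ) : ℤ) = 2 * h + 1 - 0 by push_cast; ring]
      have := pt_adj_right (d := d) (-1) (2 * h + 1 - 0)
      rw [show (-1 : ℤ) + 1 = 0 by norm_num] at this
      exact this.symm
    · rw [glue_D h6 (by omega), glue_D (by omega) ht,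
        show 2 * n + 4 * h + 5 - (t : ℤ) = (2 * n + 4 * h + 5 - ((t + 1 : ℕ) : ℤ)) + 1 by push_cast; ring]
      exact (pt_adj_up _ _).symm
  -- injectivity
  have hinj : ∀ s t, s ≤ 2 * n + 4 * h + 5 → t ≤ 2 * n + 4 * h + 5 → glue h n b₁ b₂ s = glue h n b₁ b₂ t → s = t := by
    suffices key : ∀ s t, s < t → t ≤ 2 * n + 4 * h + 5 → glue h n b₁ b₂ s ≠ glue h n b₁ b₂ t by
      intro s t hs ht hst
      by_contra hne
      rcases Nat.lt_or_gt_of_ne hne with hlt | hlt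
      · exact key s t hlt ht hst
      · exact key t s hlt hs hst.symm
    intro s t hst ht heq
    have hc := congrFun heq 0
    have hr := congrFun heq (hI d)
    rcases le_or_gt s n with hsA | hsA
    · have hs' := hA s hsA
      rcases le_or_gt t n with htA | htA
      · rw [glue_A hsA, glue_A htA] at heq
        have := h1inj (show s ≤ n from hsA) (show t ≤ n from htA) heq; omega
      rcases le_or_gt t (n + 2 * h + 2) with htB | htB
      · have := hB t htA htB; omega
      rcases le_or_gt t (2 * n + 2 * h + 3) with htC | htC
      · have := hC t htB htC; omega
      · have := hD t htC ht; omega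
    rcases le_or_gt s (n + 2 * h + 2) with hsB | hsB
    · have hs' := hB s hsA hsB
      rcases le_or_gt t (n + 2 * h + 2) with htB | htB
      · have := hB t (by omega) htB; omega
      rcases le_or_gt t (2 * n + 2 * h + 3) with htC | htC
      · have := hC t htB htC; omega
      · have := hD t htC ht; omega
    rcases le_or_gt s (2 * n + 2 * h + 3) with hsC | hsC
    · have hs' := hC s hsB hsC
      rcases le_or_gt t (2 * n + 2 * h + 3) with htC | htC
      · rw [glue_C hsB hsC, glue_C (by omega) htC] at heq
        have h1 := vrefl_injective h heq
        have := h2inj (show 2 * n + 2 * h + 3 - s ≤ n by omega) (show 2 * n + 2 * h + 3 - t ≤ n by omega) h1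
        omega
      · have := hD t htC ht; omega
    · have hs' := hD s hsC (by omega); have := hD t (by omega) ht; omega
  -- assemble the membership
  unfold tubePolygonPairs
  rw [Finset.mem_filter, mem_tubePairs]
  refine ⟨⟨zero_mem_tubeStarts _ _ _, mem_saws.2 ⟨by show glue h n b₁ b₂ 0 = 0; rw [glue_A (Nat.zero_le _), h10], fun t ht => ?_, fun t ht => ?_,
    fun s hs t ht hst => ?_⟩, fun m hm => ?_⟩, by omega, ?_⟩
  · rw [show 2 * n + 4 * h + 6 - 1 = 2 * n + 4 * h + 5 by omega] at ht ⊢; exact glue_frozen ht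
  · exact hadj t (by omega)
  · simp only [Set.mem_setOf_eq] at hs ht
    exact hinj s t (by omega) (by omega) hst
  · rw [zero_add]; exact hTube m (by omega)
  · show (zdGraph (d + 2)).Adj (glue h n b₁ b₂ (2 * n + 4 * h + 6 - 1)) 0
    rw [show 2 * n + 4 * h + 6 - 1 = 2 * n + 4 * h + 5 by omega, glue_D (by omega) le_rfl, ← pt_zero_zero,
      show 2 * n + 4 * h + 5 - ((2 * n + 4 * h + 5 : ℕ) : ℤ) = 0 by push_cast; ring]
    have := pt_adj_right (d := d) (-1) 0
    rwa [show (-1 : ℤ) + 1 = 0 by norm_num] at this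

/-- **The gluing is injective** on pairs of floor-to-floor bridges. [cite: MadrasSlade1993, Theorem 8.2.2 (this file's gluing)] -/
theorem glue_injOn :
    Set.InjOn (fun q : (ℕ → Site (d + 2)) × (ℕ → Site (d + 2)) => ((0 : Site (d + 2)), glue h n q.1 q.2))
      ((tubeBridges (d + 2) 1 h n ×ˢ tubeBridges (d + 2) 1 h n : Finset _) : Set _) := by
  rintro ⟨b₁, b₂⟩ hb ⟨b₁', b₂'⟩ hb' heq
  rw [Finset.mem_coe, Finset.mem_product] at hb hb'
  obtain ⟨-, h1fr, -⟩ := bridge_facts hb.1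
  obtain ⟨-, h2fr, -⟩ := bridge_facts hb.2
  obtain ⟨-, h1fr', -⟩ := bridge_facts hb'.1
  obtain ⟨-, h2fr', -⟩ := bridge_facts hb'.2
  have hpt : ∀ t, glue h n b₁ b₂ t = glue h n b₁' b₂' t := fun t => congrFun (Prod.ext_iff.1 heq).2 t
  have e1 : ∀ t, t ≤ n → b₁ t = b₁' t := fun t ht => by
    have := hpt t; rwa [glue_A ht, glue_A ht] at this
  have e2 : ∀ s, s ≤ n → b₂ s = b₂' s := fun s hs => by
    have := hpt (2 * n + 2 * h + 3 - s)
    rw [glue_C (by omega) (by omega), glue_C (by omega) (by omega),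
      show 2 * n + 2 * h + 3 - (2 * n + 2 * h + 3 - s) = s by omega] at this
    exact vrefl_injective h this
  refine Prod.ext (funext fun t => ?_) (funext fun t => ?_)
  · rcases le_or_gt t n with ht | ht
    · exact e1 t ht
    · rw [h1fr t ht.le, h1fr' t ht.le]; exact e1 n le_rfl
  · rcases le_or_gt t n with ht | ht
    · exact e2 t ht
    · rw [h2fr t ht.le, h2fr' t ht.le]; exact e2 n le_rfl

/-! ### Counting -/

/-- Pairs of floor-to-floor bridges of `R[1,h]` with equal spans. [cite: MadrasSlade1993, Theorem 8.2.2 (this file's gluing)] -/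
def eqSpanPairs (h n : ℕ) : Finset ((ℕ → Site (d + 2)) × (ℕ → Site (d + 2))) :=
  (tubeBridges (d + 2) 1 h n ×ˢ tubeBridges (d + 2) 1 h n).filter fun q => q.1 n 0 = q.2 n 0

/-- Equal-span pairs inject into rooted polygons. [cite: MadrasSlade1993, Theorem 8.2.2 (this file's gluing)] -/
theorem card_eqSpanPairs_le :
    (eqSpanPairs (d := d) h n).card ≤ tubePolygonCount (d + 2) 1 (2 * h + 1) (2 * n + 4 * h + 6) := by
  rw [tubePolygonCount]
  refine Finset.card_le_card_of_injOn (fun q => ((0 : Site (d + 2)), glue h n q.1 q.2)) (fun q hq => ?_)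
    (glue_injOn.mono fun q hq => ?_)
  · rw [Finset.mem_coe, eqSpanPairs, Finset.mem_filter, Finset.mem_product] at hq
    exact Finset.mem_coe.2 (glue_mem hq.1.1 hq.1.2 hq.2)
  · rw [Finset.mem_coe, eqSpanPairs, Finset.mem_filter] at hq
    exact Finset.mem_coe.2 hq.1

/-- **`β_n⟨h⟩² ≤ (n+1) q̃_{2n+4h+6}(R[1,2h+1])`** (Cauchy–Schwarz over the spans).
[cite: MadrasSlade1993, Theorem 8.2.2 (this file's gluing)] -/
theorem sq_tubeBeta_le (h n : ℕ) :
    tubeBeta (d + 2) 1 h n ^ 2 ≤ (n + 1) * tubePolygonCount (d + 2) 1 (2 * h + 1) (2 * n + 4 * h + 6) := by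
  classical
  set B := tubeBridges (d + 2) 1 h n with hB
  set f : ℕ → ℕ := fun M => (B.filter fun b => b n 0 = (M : ℤ)).card with hf
  have hspan : ∀ b ∈ B, (b n 0).toNat ∈ Finset.range (n + 1) ∧ ((b n 0).toNat : ℤ) = b n 0 := fun b hb => by
    obtain ⟨-, -, -, -, -, hcol, -, hle⟩ := bridge_facts hb
    have h0 := (hcol n).1
    refine ⟨Finset.mem_range.2 ?_, Int.toNat_of_nonneg h0⟩
    have : (b n 0).toNat ≤ n := by rw [Int.toNat_le]; exact hle
    omega
  have hsum : tubeBeta (d + 2) 1 h n = ∑ M ∈ Finset.range (n + 1), f M := by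
    rw [tubeBeta, ← hB, Finset.card_eq_sum_card_fiberwise (f := fun b : ℕ → Site (d + 2) => (b n 0).toNat)
      (t := Finset.range (n + 1)) (fun b hb => (hspan b hb).1)]
    refine Finset.sum_congr rfl fun M _ => ?_
    rw [hf]
    congr 1
    ext b
    simp only [Finset.mem_filter, and_congr_right_iff]
    intro hb
    constructor
    · intro hM; rw [← hM, (hspan b hb).2]
    · intro hM; rw [hM]; simp
  have hsq : ∑ M ∈ Finset.range (n + 1), f M ^ 2 ≤ (eqSpanPairs (d := d) h n).card := by
    have hdisj : Set.PairwiseDisjoint (↑(Finset.range (n + 1)) : Set ℕ)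
        (fun M => (B.filter fun b => b n 0 = (M : ℤ)) ×ˢ (B.filter fun b => b n 0 = (M : ℤ))) := by
      intro M _ M' _ hMM'
      rw [Function.onFun, Finset.disjoint_left]
      rintro ⟨b₁, b₂⟩ h1 h2
      rw [Finset.mem_product, Finset.mem_filter, Finset.mem_filter] at h1 h2
      have : (M : ℤ) = M' := h1.1.2.symm.trans h2.1.2
      exact hMM' (by exact_mod_cast this)
    calc ∑ M ∈ Finset.range (n + 1), f M ^ 2
        = ∑ M ∈ Finset.range (n + 1), ((B.filter fun b => b n 0 = (M : ℤ)) ×ˢ (B.filter fun b => b n 0 = (M : ℤ))).card := by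
          refine Finset.sum_congr rfl fun M _ => ?_; rw [Finset.card_product, hf, sq]
      _ = ((Finset.range (n + 1)).biUnion fun M =>
            (B.filter fun b => b n 0 = (M : ℤ)) ×ˢ (B.filter fun b => b n 0 = (M : ℤ))).card :=
          (Finset.card_biUnion hdisj).symm
      _ ≤ (eqSpanPairs (d := d) h n).card := by
          refine Finset.card_le_card fun q hq => ?_
          rw [Finset.mem_biUnion] at hq
          obtain ⟨M, -, hM⟩ := hq
          rw [Finset.mem_product, Finset.mem_filter, Finset.mem_filter] at hM
          rw [eqSpanPairs, Finset.mem_filter, Finset.mem_product]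
          exact ⟨⟨hM.1.1, hM.2.1⟩, hM.1.2.trans hM.2.2.symm⟩
  have hcs : (∑ M ∈ Finset.range (n + 1), f M) ^ 2 ≤ (Finset.range (n + 1)).card * ∑ M ∈ Finset.range (n + 1), f M ^ 2 :=
    sq_sum_le_card_mul_sum_sq
  rw [Finset.card_range] at hcs
  rw [hsum]
  exact hcs.trans (Nat.mul_le_mul_left _ (hsq.trans card_eqSpanPairs_le))

/-! ### Analysis -/

/-- For `a < μ(R[1,h])`, eventually `a^{2n+4h+6} ≤ q̃_{2n+4h+6}(R[1,2h+1])`.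
[cite: MadrasSlade1993, Theorem 8.2.2 (this file's gluing); §8.2, eq. (8.2.7)] -/
theorem eventually_pow_le_tubePolygonCount (h : ℕ) {a : ℝ} (ha0 : 0 < a) (ha : a < tubeConnectiveConstant (d + 2) 1 h) :
    ∀ᶠ n : ℕ in atTop, a ^ (2 * n + 4 * h + 6) ≤ (tubePolygonCount (d + 2) 1 (2 * h + 1) (2 * n + 4 * h + 6) : ℝ) := by
  set a' := (a + tubeConnectiveConstant (d + 2) 1 h) / 2 with ha'
  have haa' : a < a' := by rw [ha']; linarith
  have ha'μ : a' < tubeConnectiveConstant (d + 2) 1 h := by rw [ha']; linarith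
  have ha'0 : 0 < a' := ha0.trans haa'
  have hev := eventually_pow_le_tubeBeta (d := d + 2) (k := 1) le_rfl h ha'0.le ha'μ
  have hr : |(a / a') ^ 2| < 1 := by
    rw [abs_of_nonneg (by positivity)]
    exact pow_lt_one₀ (by positivity) ((div_lt_one ha'0).2 haa') two_ne_zero
  have hlim : Tendsto (fun n : ℕ => a ^ (4 * h + 6) * 2 * ((n : ℝ) ^ 1 * ((a / a') ^ 2) ^ n)) atTop (𝓝 0) := by
    have := (tendsto_pow_const_mul_const_pow_of_abs_lt_one 1 hr).const_mul (a ^ (4 * h + 6) * 2)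
    rwa [mul_zero] at this
  filter_upwards [hev, (tendsto_order.1 hlim).2 1 one_pos, eventually_ge_atTop 1] with n hn hsmall hn1
  have hq' : (tubeBeta (d + 2) 1 h n : ℝ) ^ 2 ≤ ((n : ℝ) + 1) * tubePolygonCount (d + 2) 1 (2 * h + 1) (2 * n + 4 * h + 6) := by
    exact_mod_cast sq_tubeBeta_le (d := d) h n
  have h1 : a' ^ (2 * n) ≤ (tubeBeta (d + 2) 1 h n : ℝ) ^ 2 := by
    rw [mul_comm, pow_mul]; exact pow_le_pow_left₀ (by positivity) hn 2
  have hn1' : (1 : ℝ) ≤ n := by exact_mod_cast hn1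
  have h2 : a ^ (2 * n + 4 * h + 6) * ((n : ℝ) + 1) ≤ a' ^ (2 * n) := by
    have key : a ^ (2 * n) = ((a / a') ^ 2) ^ n * a' ^ (2 * n) := by
      rw [pow_mul, pow_mul, ← mul_pow]; congr 1; field_simp
    have e : a ^ (2 * n + 4 * h + 6) * ((n : ℝ) + 1) =
        (a ^ (4 * h + 6) * ((n : ℝ) + 1) * ((a / a') ^ 2) ^ n) * a' ^ (2 * n) := by
      rw [show 2 * n + 4 * h + 6 = 2 * n + (4 * h + 6) by ring, pow_add, key]; ring
    rw [e]
    have h3 : a ^ (4 * h + 6) * ((n : ℝ) + 1) * ((a / a') ^ 2) ^ n ≤ 1 := by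
      calc a ^ (4 * h + 6) * ((n : ℝ) + 1) * ((a / a') ^ 2) ^ n
          ≤ a ^ (4 * h + 6) * (2 * n) * ((a / a') ^ 2) ^ n := by gcongr; linarith
        _ = a ^ (4 * h + 6) * 2 * ((n : ℝ) ^ 1 * ((a / a') ^ 2) ^ n) := by ring
        _ ≤ 1 := hsmall.le
    calc (a ^ (4 * h + 6) * ((n : ℝ) + 1) * ((a / a') ^ 2) ^ n) * a' ^ (2 * n) ≤ 1 * a' ^ (2 * n) :=
          mul_le_mul_of_nonneg_right h3 (by positivity)
      _ = a' ^ (2 * n) := one_mul _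
  have hN0 : (0 : ℝ) < (n : ℝ) + 1 := by positivity
  have := (h2.trans h1).trans hq'
  rw [mul_comm ((n : ℝ) + 1)] at this
  exact le_of_mul_le_mul_right this hN0

/-- From `q̃_N ≤ C ρ^N` for all `N` to `π(R[1,T]) ≤ ρ`. [folklore] -/
private theorem tubePolygonRate_le_of_le_mul_pow {T : ℕ} {C ρ : ℝ} (hρ : 0 < ρ)
    (hb : ∀ N, (tubePolygonCount (d + 2) 1 T N : ℝ) ≤ C * ρ ^ N) : tubePolygonRate (d + 2) 1 T ≤ ρ := by
  unfold tubePolygonRate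
  refine le_of_forall_gt_imp_ge_of_dense fun ρ' hρ' => ?_
  have hρ'0 : 0 < ρ' := hρ.trans hρ'
  have hr : |ρ / ρ'| < 1 := by rw [abs_of_pos (div_pos hρ hρ'0), div_lt_one hρ'0]; exact hρ'
  have hlim : Tendsto (fun N : ℕ => |C| * ((N : ℝ) ^ 0 * (ρ / ρ') ^ N)) atTop (𝓝 0) := by
    have := (tendsto_pow_const_mul_const_pow_of_abs_lt_one 0 hr).const_mul |C|
    rwa [mul_zero] at this
  have hev0 : ∀ᶠ n : ℕ in atTop, (tubePolygonCount (d + 2) 1 T n : ℝ) ≤ ρ' ^ n := by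
    filter_upwards [(tendsto_order.1 hlim).2 1 one_pos] with N hN
    have hbound : C * (ρ / ρ') ^ N ≤ 1 := by
      calc C * (ρ / ρ') ^ N ≤ |C| * (ρ / ρ') ^ N := by gcongr; exact le_abs_self C
        _ = |C| * ((N : ℝ) ^ 0 * (ρ / ρ') ^ N) := by ring
        _ ≤ 1 := hN.le
    calc (tubePolygonCount (d + 2) 1 T N : ℝ) ≤ C * ρ ^ N := hb N
      _ = (C * (ρ / ρ') ^ N) * ρ' ^ N := by rw [div_pow]; field_simp
      _ ≤ 1 * ρ' ^ N := mul_le_mul_of_nonneg_right hbound (by positivity)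
      _ = ρ' ^ N := one_mul _
  obtain ⟨n₀, hn₀⟩ := eventually_atTop.1 hev0
  have hev : ∀ᶠ N : ℕ in atTop,
      ((tubePolygonCount (d + 2) 1 T (2 * N + 2) : ℝ)) ^ (1 / (2 * (N : ℝ) + 2)) ≤ ρ' := by
    filter_upwards [eventually_ge_atTop n₀] with N hN
    have hn : (2 * (N : ℝ) + 2) = ((2 * N + 2 : ℕ) : ℝ) := by push_cast; ring
    calc ((tubePolygonCount (d + 2) 1 T (2 * N + 2) : ℝ)) ^ (1 / (2 * (N : ℝ) + 2))
        ≤ (ρ' ^ (2 * N + 2)) ^ (1 / (2 * (N : ℝ) + 2)) :=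
          Real.rpow_le_rpow (Nat.cast_nonneg _) (hn₀ _ (by omega)) (by positivity)
      _ = ρ' := by rw [hn, one_div, Real.pow_rpow_inv_natCast hρ'0.le (by omega)]
  exact Filter.limsup_le_of_le
    (Filter.isCoboundedUnder_le_of_le atTop fun N => Real.rpow_nonneg (Nat.cast_nonneg _) _) hev

end TubePolygonLower

/-! ### The theorems -/

section Theorems

open TubePolygonLower

variable {d : ℕ}

/-- **`μ(R[1,h]) ≤ π(R[1,2h+1])` in every dimension `d+2 ≥ 2`** — the connective constant of the tube
`ℤ × {0,…,h}^{d+1}` is at most the polygon growth rate of the tube `ℤ × {0,…,2h+1}^{d+1}` (two equal-span floor-to-floor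
bridges of the smaller tube glue, through the last coordinate, to a polygon of the larger one).
[cite: MadrasSlade1993, Theorem 8.2.2 (pp. 270–271) and Theorem 8.2.1 (p. 269) (context; this comparison is not printed there)] -/
theorem tubeConnectiveConstant_le_tubePolygonRate_double' (h : ℕ) :
    tubeConnectiveConstant (d + 2) 1 h ≤ tubePolygonRate (d + 2) 1 (2 * h + 1) := by
  refine le_of_forall_lt_imp_le_of_dense fun a ha => ?_
  have hμ1 : 1 ≤ tubePolygonRate (d + 2) 1 (2 * h + 1) := TubePolygon.one_le_tubePolygonRate (d := d) (by omega)
  rcases le_or_gt a 0 with ha0 | ha0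
  · linarith
  have hev := eventually_pow_le_tubePolygonCount (d := d) h ha0 ha
  have hbdd : IsBoundedUnder (· ≤ ·) atTop
      (fun N : ℕ => (tubePolygonCount (d + 2) 1 (2 * h + 1) (2 * N + 2) : ℝ) ^ (1 / (2 * (N : ℝ) + 2))) :=
    TubePolygon.isBoundedUnder_polygon (d := d) (2 * h + 1)
  unfold tubePolygonRate
  refine Filter.le_limsup_of_frequently_le ?_ hbdd
  rw [Filter.frequently_atTop]
  intro N₀
  obtain ⟨n₀, hn₀⟩ := Filter.eventually_atTop.1 hev
  refine ⟨max N₀ n₀ + 2 * h + 2, by omega, ?_⟩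
  set n := max N₀ n₀ with hn
  have hnn : n₀ ≤ n := le_max_right _ _
  have e1 : 2 * (n + 2 * h + 2) + 2 = 2 * n + 4 * h + 6 := by ring
  have e2 : (2 * ((n + 2 * h + 2 : ℕ) : ℝ) + 2) = ((2 * n + 4 * h + 6 : ℕ) : ℝ) := by push_cast; ring
  rw [e1, e2]
  calc a = (a ^ (2 * n + 4 * h + 6)) ^ (1 / ((2 * n + 4 * h + 6 : ℕ) : ℝ)) := by
        rw [one_div, Real.pow_rpow_inv_natCast ha0.le (by omega)]
    _ ≤ ((tubePolygonCount (d + 2) 1 (2 * h + 1) (2 * n + 4 * h + 6) : ℕ) : ℝ) ^ (1 / ((2 * n + 4 * h + 6 : ℕ) : ℝ)) :=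
        Real.rpow_le_rpow (by positivity) (hn₀ n hnn) (by positivity)

/-- **`π(R[1,T]) ≤ μ(R[1,T])`** in every dimension (`q̃_N(R) ≤ c_{N-1}(R)`, the non-strict half of Theorem 8.2.2 (b)/(c)).
[cite: MadrasSlade1993, Theorem 8.2.2 (pp. 270–271)] -/
theorem tubePolygonRate_le_tubeConnectiveConstant' (T : ℕ) :
    tubePolygonRate (d + 2) 1 T ≤ tubeConnectiveConstant (d + 2) 1 T := by
  refine le_of_forall_gt_imp_ge_of_dense fun ρ hρ => ?_
  have hρ0 : 0 < ρ := (tubeConnectiveConstant_pos (d := d + 2) le_rfl T).trans hρ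
  obtain ⟨D, hD, hDb⟩ := CornerDecomp.exists_tubeCount_le_mul_pow (d := d + 2) le_rfl T hρ
  refine tubePolygonRate_le_of_le_mul_pow (C := D / ρ) hρ0 fun N => ?_
  have h1 : tubePolygonCount (d + 2) 1 T N ≤ tubeCount (d + 2) 1 T (N - 1) := by
    unfold tubePolygonCount tubePolygonPairs tubeCount; exact Finset.card_filter_le _ _
  rcases Nat.eq_zero_or_pos N with rfl | hN
  · have : tubePolygonCount (d + 2) 1 T 0 = 0 := by
      unfold tubePolygonCount tubePolygonPairs; simp
    rw [this]; simp; positivity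
  · calc (tubePolygonCount (d + 2) 1 T N : ℝ) ≤ tubeCount (d + 2) 1 T (N - 1) := by exact_mod_cast h1
      _ ≤ D * ρ ^ (N - 1) := hDb _
      _ = D / ρ * ρ ^ N := by
          rw [show N = N - 1 + 1 from (Nat.sub_add_cancel hN).symm, pow_succ, Nat.add_sub_cancel]; field_simp

/-- **Every tube height: `μ(R[1,⌊(T-1)/2⌋]) ≤ π(R[1,T])`** (`T ≥ 1`; odd `T` direct, even `T` via the monotonicity
`TubeInsertion.tubePolygonRate_lt_succ`). [cite: MadrasSlade1993, Theorem 8.2.2 (pp. 270–271; this file's comparison)] -/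
theorem tubeConnectiveConstant_half_le_tubePolygonRate' {T : ℕ} (hT : 1 ≤ T) :
    tubeConnectiveConstant (d + 2) 1 ((T - 1) / 2) ≤ tubePolygonRate (d + 2) 1 T := by
  have h1 := tubeConnectiveConstant_le_tubePolygonRate_double' (d := d) ((T - 1) / 2)
  rcases Nat.even_or_odd (T - 1) with he | ho
  · have e : 2 * ((T - 1) / 2) + 1 = T := by obtain ⟨k, hk⟩ := he; omega
    rwa [e] at h1
  · have e : 2 * ((T - 1) / 2) + 1 + 1 = T := by obtain ⟨k, hk⟩ := ho; omega
    have h2 := TubeInsertion.tubePolygonRate_lt_succ (d := d) (L := 2 * ((T - 1) / 2) + 1) (by omega)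
    rw [e] at h2
    exact h1.trans h2.le

/-- **The polygon analogue of Madras–Slade (8.2.12) for the one-dimensional tubes, every dimension:
`lim_{T→∞} π(R[1,T]) = μ(ℤ^{d+2})`** — squeezed between `μ(R[1,⌊(T-1)/2⌋])` and `μ(R[1,T])`, both converging to `μ`
by (8.2.12) (`tendsto_tubeConnectiveConstant`). [cite: MadrasSlade1993, Theorem 8.2.2 (a)–(c) p. 271 and Theorem 8.2.1 (8.2.12) p. 269 (walks; the polygon limit for k = 1 is not printed there)]
[cite: Whittington2009LatticePolygons, §2.9.2 p. 38 (slabs k = d−1: "lim κ(L) = κ"; slits/prisms: existence and strict inequality only)]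
[cite: GuttmannJensen2009Confinement, §10.1 pp. 236–237 (π_w monotone; Daoud–de Gennes scaling)] -/
theorem tendsto_tubePolygonRate :
    Tendsto (fun T : ℕ => tubePolygonRate (d + 2) 1 T) atTop (𝓝 (connectiveConstant (d + 2))) := by
  have hup : Tendsto (fun T : ℕ => tubeConnectiveConstant (d + 2) 1 T) atTop (𝓝 (connectiveConstant (d + 2))) :=
    tendsto_tubeConnectiveConstant (d := d + 2) le_rfl
  have hhalf : Tendsto (fun T : ℕ => (T - 1) / 2) atTop atTop := by
    refine Filter.tendsto_atTop_atTop.2 fun b => ⟨2 * b + 1, fun T hT => ?_⟩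
    omega
  have hlo : Tendsto (fun T : ℕ => tubeConnectiveConstant (d + 2) 1 ((T - 1) / 2)) atTop (𝓝 (connectiveConstant (d + 2))) :=
    hup.comp hhalf
  refine tendsto_of_tendsto_of_tendsto_of_le_of_le' hlo hup ?_ (Eventually.of_forall fun T => ?_)
  · filter_upwards [eventually_ge_atTop 1] with T hT
    exact tubeConnectiveConstant_half_le_tubePolygonRate' hT
  · exact tubePolygonRate_le_tubeConnectiveConstant' T

/-- **The polygon analogue of (8.2.12) for EVERY tube/slab `R[k,T] ⊂ ℤ^{d+2}`, `1 ≤ k ≤ d+1`: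
`lim_{T→∞} π(R[k,T]) = μ(ℤ^{d+2})`** — `k = 1`: `tendsto_tubePolygonRate`; `k ≥ 2`: `π(R[k,T]) = μ(R[k,T])`
(Theorem 8.2.2 (c), `MadrasSlade1993_thm822c`) and (8.2.12). [cite: MadrasSlade1993, Theorem 8.2.2 (c) p. 271 with Theorem 8.2.1 (8.2.12) p. 269 (k ≥ 2); k = 1: this file]
[cite: Whittington2009LatticePolygons, §2.9.2 p. 38 ("lim κ(L) = κ" for slabs)] -/
theorem tendsto_tubePolygonRate_of_le {k : ℕ} (hk : 1 ≤ k) (hkd : k + 1 ≤ d + 2) :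
    Tendsto (fun T : ℕ => tubePolygonRate (d + 2) k T) atTop (𝓝 (connectiveConstant (d + 2))) := by
  rcases hk.eq_or_lt with h1 | h2
  · subst h1; exact tendsto_tubePolygonRate
  · have e : (fun T : ℕ => tubePolygonRate (d + 2) k T) = fun T => tubeConnectiveConstant (d + 2) k T :=
      funext fun T => MadrasSlade1993_thm822c (by omega) hkd T
    rw [e]; exact tendsto_tubeConnectiveConstant (d := d + 2) hk

/-- **An explicit locality rate for tube POLYGONS, every dimension**: for `T ≥ 3`,
`0 ≤ log μ(ℤ^{d+2}) - log π(R[1,T]) ≤ (4 log μ + 8(d+2) + 32) / √⌊(T-1)/2⌋` — the lower comparison with the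
half-width tube and the tree's explicit (8.2.12) rate `log_sub_log_tubeConnectiveConstant_le` (`SAWTubeLocality.lean`);
the left inequality is `π(R[1,T]) ≤ μ(R[1,T]) ≤ μ`. [cite: MadrasSlade1993, Theorem 8.2.1, eq. (8.2.12) (p. 269; polygon analogue with an explicit rate)] -/
theorem log_connectiveConstant_sub_log_tubePolygonRate_le' {T : ℕ} (hT : 3 ≤ T) :
    0 ≤ Real.log (connectiveConstant (d + 2)) - Real.log (tubePolygonRate (d + 2) 1 T) ∧
    Real.log (connectiveConstant (d + 2)) - Real.log (tubePolygonRate (d + 2) 1 T) ≤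
      (4 * Real.log (connectiveConstant (d + 2)) + 8 * (d + 2 : ℕ) + 32) / Real.sqrt (((T - 1) / 2 : ℕ) : ℝ) := by
  have hh : 1 ≤ (T - 1) / 2 := by omega
  have h1 := (log_sub_log_tubeConnectiveConstant_le (d := d + 2) (k := 1) le_rfl hh).2
  have h2 := tubeConnectiveConstant_half_le_tubePolygonRate' (d := d) (T := T) (by omega)
  have h3 := tubePolygonRate_le_tubeConnectiveConstant' (d := d) T
  have h4 := tubeConnectiveConstant_le (d := d + 2) (k := 1) le_rfl T
  have hpos : 0 < tubeConnectiveConstant (d + 2) 1 ((T - 1) / 2) := tubeConnectiveConstant_pos (d := d + 2) le_rfl _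
  have hπpos : 0 < tubePolygonRate (d + 2) 1 T := hpos.trans_le h2
  have h5 := Real.log_le_log hpos h2
  have h6 := Real.log_le_log hπpos (h3.trans h4)
  exact ⟨by linarith, by linarith⟩

end Theorems

end Literature.Probability.RandomPlanarGeometry.SAW.Zd

end
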